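/-
Copyright (c) 2026. All rights reserved.
Released under Apache 2.0 license as described in the file LICENSE.
Authors: abc-iut cell, prover seat abc-iut-w5-d017 (wave 5, gen 5).
-/
import Literature.IUT.LogVolume.UnitLogWildDyadicInhabited
import Literature.IUT.LogVolume.UnitLogWildDyadic
import HarnessLib

/-!
# Dyadic places with residue field `𝔽₂` and `e ≡ 2 (mod 4)`: the `2`-adic logarithm of a unit is never a unit

Proof-only sequel (theorems, no definitions) of abc-iut-w5-d172's `UnitLogWildDyadic.lean` (`e(K/ℚ₂) = 2`,
`f(K/ℚ₂) = 1` ⇒ `log₂(𝒪_K^×) ⊆ 𝔪_K`) and of abc-iut-w5-d017's `UnitLogWildDyadicInhabited.lean`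
(`2 ∣ e`, `f ≥ 2` ⇒ some unit has a unit logarithm).  Here: **`f(K/ℚ₂) = 1` and `e(K/ℚ₂) = 2k` with `k`
ODD ⇒ `‖log₂ u‖ ≠ 1` for every `u : K`** (`norm_unitLog_ne_one_of_residueDegree_eq_one`), so
`log₂(𝒪_K^×)` misses the unit sphere (`logUnits_inter_sphere_eq_empty_of_residueDegree_eq_one`); e.g.
`ℚ₂(√−1)`, `ℚ₂(√2)` (`e = 2`), and every `K/ℚ₂` with `f = 1`, `e ∈ {2, 6, 10, …}`.

PROOF, with the dominant-term toolkit (`LogSeriesDominantTerm.lean`): for a principal `y` with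
`‖1 − y‖ = ‖ϖ‖^s` the exponents are `h(a) = s·2^a − 2k·a`.  If `s = k` the indices `2, 4` tie at exponent
`0` and every other index has exponent `≥ 1`; with `w = (1−y)²/2` a unit and `f = 1`, `w ≡ 1`, so
`1 + w ≡ 2 ≡ 0 (mod 𝔪)` and the tied pair `−w(1 + w)` lies in `𝔪`: `‖L(y)‖ < 1`
(`norm_logSeries_lt_one_of_eq`).  If `s ≠ k`: a tie at the turning point `a₀ ≥ 1` would force
`2k = s·2^{a₀}`, i.e. `k = s·2^{a₀−1}`, so (`k` odd) `a₀ = 1`, `s = k` — excluded; and `h(a₀) = 0` would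
force `s·2^{a₀−1} = k·a₀`, impossible for odd `k` unless `s = k` (`a₀ ∈ {1, 2}`) since `2^{a₀−1} ∤ a₀` for
`a₀ ≥ 3`; hence either all exponents are `≥ 1` (`‖L(y)‖ < 1`) or a unique dominant term with exponent
`< 0` (`‖L(y)‖ > 1`) — `norm_logSeries_ne_one_of_ne`.  Units reduce to principal units by an odd power.

State of the dyadic census after this file (all kernel): `e` odd ⇒ empty (p432860); `2 ∣ e`, `f ≥ 2` ⇒
inhabited (p433557); `f = 1`, `e ≡ 2 (mod 4)` ⇒ empty (this file); `f = 1`, `4 ∣ e` — undecided here.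
Classical (Neukirch, *Algebraic Number Theory* II (5.5)).  Nothing here is disputed mathematics; no IUT
statement is asserted; nothing bears on [IUTchIII] Cor. 3.12.
-/

noncomputable section

open Metric Set

namespace Literature.IUT.LogVolume

namespace RamificationCriterion

open Literature.NumberTheory.GaloisRepresentations.Ultrametric

variable {K : Type*} [NontriviallyNormedField K] [instK : NormedAlgebra ℚ_[2] K] [IsUltrametricDist K]
  [ProperSpace K]

/-! ### §1. `s = k`: the tied pair lies in `𝔪` when every unit is principal -/

/-- **`e = 2k`, `‖1 − y‖ = ‖ϖ‖^k`, every unit principal ⇒ `‖L(y)‖ < 1`**: the terms of index `2` and `4` sum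
to `−w(1 + w)` with `w = (1−y)²/2` a PRINCIPAL unit, so `1 + w = 2 − (1 − w) ∈ 𝔪`; all other terms have
norm `≤ ‖ϖ‖`. [cite: NeukirchANT1999, Ch. II (5.5)] -/
theorem norm_logSeries_lt_one_of_eq {ϖ : Kˣ} (hϖ : IsUniformizer ϖ) {k : ℕ}
    (hk : absRamificationIdx 2 K = 2 * k) (hprinc : ∀ u : K, ‖u‖ = 1 → IsPrincipal u) {y : K}
    (hy : ‖1 - y‖ = ‖(ϖ : K)‖ ^ (k : ℤ)) : ‖logSeries y‖ < 1 := by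
  classical
  have hρ0 : 0 < ‖(ϖ : K)‖ := norm_units_pos ϖ
  have he1 : 1 ≤ absRamificationIdx 2 K := absRamificationIdx_pos 2 K
  have hk1 : 1 ≤ k := by omega
  have hyP : IsPrincipal y := by
    show ‖1 - y‖ < 1
    rw [hy]
    exact zpow_lt_one₀ hρ0 hϖ.1 (by exact_mod_cast hk1)
  set x : K := 1 - y with hx
  have h2 : ‖(2 : K)‖ = ‖(ϖ : K)‖ ^ (2 * k) := by
    have := norm_prime_eq_norm_pow 2 K hϖ
    rw [hk] at this
    exact_mod_cast this
  have h2lt : ‖(2 : K)‖ < 1 := by exact_mod_cast norm_prime_lt_one 2 K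
  have hx2 : ‖x ^ 2 / 2‖ = 1 := by
    rw [norm_div, norm_pow, hy, h2, ← zpow_natCast, ← zpow_natCast, ← zpow_mul, div_eq_one_iff_eq
      (zpow_pos hρ0 _).ne']
    congr 1
    push_cast
    ring
  -- the tied pair is in `𝔪`: `1 + w = 2 - (1 - w)`
  have hpair_lt : ‖x ^ 2 / 2 * (1 + x ^ 2 / 2)‖ < 1 := by
    rw [norm_mul, hx2, one_mul, show (1 : K) + x ^ 2 / 2 = 2 - (1 - x ^ 2 / 2) by ring]
    have hw : ‖1 - x ^ 2 / 2‖ < 1 := hprinc _ hx2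
    calc ‖(2 : K) - (1 - x ^ 2 / 2)‖ ≤ max ‖(2 : K)‖ ‖1 - x ^ 2 / 2‖ := by
          have h := IsUltrametricDist.norm_add_le_max (2 : K) (-(1 - x ^ 2 / 2))
          rwa [norm_neg, ← sub_eq_add_neg] at h
      _ < 1 := max_lt h2lt hw
  -- the series and its two special terms
  set f : ℕ → K := fun n ↦ -((1 - y) ^ (n + 1)) / (n + 1 : K) with hf
  have hsum : HasSum f (logSeries y) := hasSum_logSeries 2 hyP
  have hsum1 := hasSum_ite_sub_hasSum hsum 1
  have hsum2 := hasSum_ite_sub_hasSum hsum1 3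
  have hf1 : f 1 = -(x ^ 2 / 2) := by
    rw [hf]; dsimp only; rw [hx]; norm_num [neg_div]
  have hf3 : (fun n ↦ if n = 1 then (0 : K) else f n) 3 = -(x ^ 4 / 4) := by
    simp only [show (3 : ℕ) ≠ 1 by decide, if_false, hf, hx]
    norm_num [neg_div]
  have hpair : f 1 + (fun n ↦ if n = 1 then (0 : K) else f n) 3 = -(x ^ 2 / 2 * (1 + x ^ 2 / 2)) := by
    rw [hf1, hf3]
    have h4 : (4 : K) = 2 * 2 := by norm_num
    rw [h4]
    have h20 : (2 : K) ≠ 0 := by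
      intro h; rw [h, norm_zero] at h2; exact (pow_pos hρ0 _).ne h2
    field_simp
    ring
  have hrest : ‖logSeries y - f 1 - (fun n ↦ if n = 1 then (0 : K) else f n) 3‖ ≤ ‖(ϖ : K)‖ := by
    rw [← hsum2.tsum_eq]
    refine IsUltrametricDist.norm_tsum_le_of_forall_le_of_nonneg (norm_nonneg _) fun n ↦ ?_
    by_cases hn3 : n = 3
    · simp only [hn3, if_true, norm_zero]; exact norm_nonneg _
    by_cases hn1 : n = 1
    · simp only [hn1, if_true, show (1 : ℕ) ≠ 3 by decide, if_false, norm_zero]; exact norm_nonneg _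
    simp only [hn3, hn1, if_false]
    rw [hf]
    dsimp only
    rw [norm_logTerm_eq_zpow 2 hϖ hy n]
    calc ‖(ϖ : K)‖ ^ ((k : ℤ) * ((n + 1 : ℕ) : ℤ)
          - (absRamificationIdx 2 K : ℤ) * (padicValNat 2 (n + 1) : ℤ))
        ≤ ‖(ϖ : K)‖ ^ (1 : ℤ) := by
          refine zpow_le_zpow_right_of_le_one₀ hρ0 hϖ.1.le ?_
          rw [hk]
          exact exponent_ge_of_ne_two_four hk1 (Nat.succ_ne_zero n) (by omega) (by omega)
      _ = ‖(ϖ : K)‖ := zpow_one _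
  have hsplit : logSeries y = (f 1 + (fun n ↦ if n = 1 then (0 : K) else f n) 3)
      + (logSeries y - f 1 - (fun n ↦ if n = 1 then (0 : K) else f n) 3) := by ring
  rw [hsplit]
  refine (IsUltrametricDist.norm_add_le_max _ _).trans_lt (max_lt ?_ (hrest.trans_lt hϖ.1))
  rw [hpair, norm_neg]
  exact hpair_lt

/-- `b + 1 < 2^b` for `b ≥ 2`. [folklore] -/
private theorem succ_lt_two_pow {b : ℕ} (hb : 2 ≤ b) : b + 1 < 2 ^ b := by
  obtain ⟨d, rfl⟩ := Nat.exists_eq_add_of_le hb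
  induction d with
  | zero => norm_num
  | succ d ih => rw [show 2 + (d + 1) = 2 + d + 1 from rfl, pow_succ]; omega

/-! ### §2. `s ≠ k`, `k` odd: no tie and no zero exponent -/

/-- **`e = 2k` with `k` odd, `‖1 − y‖ = ‖ϖ‖^s` with `s ≠ k` ⇒ `‖L(y)‖ ≠ 1`.** Along `h(a) = s·2^a − 2k·a`: a
tie at the turning point `a₀ ≥ 1` needs `k = s·2^{a₀−1}` (so `a₀ = 1`, `s = k`), and `h(a₀) = 0` needs
`s·2^{a₀} = 2k·a₀` (so `s = k` for `a₀ ≤ 2`, and `2^{a₀−1} ∣ a₀` for `a₀ ≥ 3`) — both excluded; hence either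
every exponent is `≥ 1` or a unique dominant term has exponent `< 0`. [cite: NeukirchANT1999, Ch. II (5.5)] -/
theorem norm_logSeries_ne_one_of_ne {ϖ : Kˣ} (hϖ : IsUniformizer ϖ) {k : ℕ} (hkodd : Odd k)
    (hk : absRamificationIdx 2 K = 2 * k) {y : K} (hyP : IsPrincipal y) {s : ℤ}
    (hy : ‖1 - y‖ = ‖(ϖ : K)‖ ^ s) (hsk : s ≠ k) : ‖logSeries y‖ ≠ 1 := by
  classical
  have hρ0 : 0 < ‖(ϖ : K)‖ := norm_units_pos ϖ
  have he1 : 1 ≤ absRamificationIdx 2 K := absRamificationIdx_pos 2 K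
  have hk1 : 1 ≤ k := by omega
  have hs1 : 1 ≤ s := by
    have h1 : ‖(ϖ : K)‖ ^ s < 1 := hy ▸ hyP
    have := (zpow_lt_one_iff_right_of_lt_one₀ hρ0 hϖ.1).mp h1
    omega
  set e : ℕ := absRamificationIdx 2 K with he_def
  have hP : (2 : ℤ) ≤ ((2 : ℕ) : ℤ) := by norm_num
  have hek : (e : ℤ) = 2 * (k : ℤ) := by rw [hk]; push_cast; ring
  -- the turning point
  have hex : ∃ a : ℕ, (e : ℤ) ≤ s * ((2 : ℕ) : ℤ) ^ a * (((2 : ℕ) : ℤ) - 1) := exists_le_increment hs1 hP e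
  obtain ⟨a₀, hhi, hlo'⟩ : ∃ a₀ : ℕ, (e : ℤ) ≤ s * ((2 : ℕ) : ℤ) ^ a₀ * (((2 : ℕ) : ℤ) - 1) ∧
      ∀ a < a₀, ¬ (e : ℤ) ≤ s * ((2 : ℕ) : ℤ) ^ a * (((2 : ℕ) : ℤ) - 1) :=
    ⟨Nat.find hex, Nat.find_spec hex, fun a ha ↦ Nat.find_min hex ha⟩
  have hlo : ∀ a < a₀, s * ((2 : ℕ) : ℤ) ^ a * (((2 : ℕ) : ℤ) - 1) < e :=
    fun a ha ↦ lt_of_not_ge (hlo' a ha)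
  have hmin := exponent_min (a₀ := a₀) hs1 hP hlo hhi
  have hall : ∀ n : ℕ, s * ((2 : ℕ) : ℤ) ^ a₀ - e * (a₀ : ℤ)
      ≤ s * ((n + 1 : ℕ) : ℤ) - (e : ℤ) * (padicValNat 2 (n + 1) : ℤ) := by
    intro n
    obtain ⟨a, ha, -⟩ := exists_exponent_le_index (p := 2) hs1 e (Nat.succ_ne_zero n)
    exact (hmin a).trans ha
  rcases le_or_gt 1 (s * ((2 : ℕ) : ℤ) ^ a₀ - e * (a₀ : ℤ)) with hpos | hnonpos
  · have hle := norm_logSeries_le_norm_unif 2 hϖ hy fun n ↦ hpos.trans (hall n)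
    exact ne_of_lt (hle.trans_lt hϖ.1)
  · have hnonpos : s * ((2 : ℕ) : ℤ) ^ a₀ - e * (a₀ : ℤ) ≤ 0 := by omega
    have ha₀ : a₀ ≠ 0 := by
      rintro rfl
      rw [pow_zero, Nat.cast_zero, mul_zero, sub_zero, mul_one] at hnonpos
      omega
    obtain ⟨b, hb⟩ : ∃ b : ℕ, a₀ = b + 1 := ⟨a₀ - 1, by omega⟩
    obtain ⟨j, hj⟩ := hkodd
    -- no tie: `2k = s 2^{a₀}` would give `k = s 2^b`, so `b = 0` and `s = k`
    have hhi' : (e : ℤ) < s * ((2 : ℕ) : ℤ) ^ a₀ * (((2 : ℕ) : ℤ) - 1) := by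
      refine lt_of_le_of_ne hhi fun heq ↦ ?_
      rw [hek, hb, pow_succ] at heq
      push_cast at heq
      have hks : (k : ℤ) = s * 2 ^ b := by linarith
      rcases Nat.eq_zero_or_pos b with hb0 | hb0
      · rw [hb0, pow_zero, mul_one] at hks
        exact hsk hks.symm
      · -- `k = s·2^b` is even, contradiction
        obtain ⟨c, rfl⟩ : ∃ c, b = c + 1 := ⟨b - 1, (Nat.sub_add_cancel hb0).symm⟩
        have : (k : ℤ) = 2 * (s * 2 ^ c) := by rw [hks, pow_succ]; ring
        have hk2 : (2 : ℤ) ∣ (k : ℤ) := ⟨_, this⟩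
        have : (2 : ℤ) ∣ 1 := by
          have h := hj
          have : (k : ℤ) = 2 * j + 1 := by exact_mod_cast h
          rw [this] at hk2
          simpa using (Int.dvd_add_right (Dvd.intro j rfl)).mp hk2
        omega
    have hstrict : ∀ a : ℕ, a ≠ a₀ →
        s * ((2 : ℕ) : ℤ) ^ a₀ - e * (a₀ : ℤ) + 1 ≤ s * ((2 : ℕ) : ℤ) ^ a - e * (a : ℤ) :=
      fun a ha ↦ exponent_min_strict (a₀ := a₀) hs1 hP hlo hhi' ha
    -- `h(a₀) ≠ 0`
    have hne0 : s * ((2 : ℕ) : ℤ) ^ a₀ - e * (a₀ : ℤ) ≠ 0 := by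
      intro h0
      rw [hek, hb, pow_succ] at h0
      push_cast at h0
      -- `s 2^b · 2 = 2k (b+1)`, i.e. `s 2^b = k (b+1)`
      have hsb : s * 2 ^ b = (k : ℤ) * (b + 1) := by linarith
      rcases Nat.lt_or_ge b 2 with hb2 | hb2
      · interval_cases b
        · -- `b = 0`: `s = k`
          simp only [pow_zero, mul_one, Nat.cast_zero, zero_add] at hsb
          exact hsk hsb
        · -- `b = 1`: `2 s = 2 k`
          push_cast at hsb
          exact hsk (by linarith)
      · -- `b ≥ 2`: `2^b ∣ k (b+1)` with `k` odd ⇒ `2^b ∣ b + 1 < 2^b`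
        have hdvd : ((2 ^ b : ℕ) : ℤ) ∣ ((k * (b + 1) : ℕ) : ℤ) := ⟨s, by push_cast; linarith⟩
        have hdvd' : 2 ^ b ∣ k * (b + 1) := by exact_mod_cast hdvd
        have hcop : Nat.Coprime (2 ^ b) k := by
          refine Nat.Coprime.pow_left b ?_
          rw [Nat.coprime_two_left, Nat.odd_iff]
          omega
        have hdvd'' : 2 ^ b ∣ b + 1 := hcop.dvd_of_dvd_mul_left hdvd'
        have hle : 2 ^ b ≤ b + 1 := Nat.le_of_dvd (Nat.succ_pos b) hdvd''
        have hlt : b + 1 < 2 ^ b := succ_lt_two_pow hb2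
        omega
    -- the dominant index `n₀ + 1 = 2^{a₀}`
    obtain ⟨n₀, hn₀1⟩ : ∃ n₀ : ℕ, n₀ + 1 = 2 ^ a₀ :=
      ⟨2 ^ a₀ - 1, Nat.sub_add_cancel (Nat.one_le_pow _ _ (by norm_num))⟩
    have hN₀ : s * ((n₀ + 1 : ℕ) : ℤ) - (e : ℤ) * (padicValNat 2 (n₀ + 1) : ℤ)
        = s * ((2 : ℕ) : ℤ) ^ a₀ - e * (a₀ : ℤ) := by
      rw [hn₀1, padicValNat.prime_pow]
      push_cast
      ring
    have hdom : ∀ n : ℕ, n ≠ n₀ → s * ((2 : ℕ) : ℤ) ^ a₀ - e * (a₀ : ℤ) + 1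
        ≤ s * ((n + 1 : ℕ) : ℤ) - (e : ℤ) * (padicValNat 2 (n + 1) : ℤ) := by
      intro n hn
      obtain ⟨a, ha, ha'⟩ := exists_exponent_le_index (p := 2) hs1 e (Nat.succ_ne_zero n)
      by_cases haa : a = a₀
      · have hne : n + 1 ≠ 2 ^ a := by
          rw [haa, ← hn₀1]; intro h; exact hn (by omega)
        have := ha' hne
        rw [haa] at this
        exact this
      · exact (hstrict a haa).trans ha
    have hnorm := norm_logSeries_eq_zpow_of_dominant 2 hϖ hyP hy n₀ hN₀ hdom
    rw [hnorm]
    intro h1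
    exact hne0 (zpow_right_injective₀ hρ0 hϖ.1.ne (h1.trans (zpow_zero _).symm))

/-! ### §3. `f = 1`, `e ≡ 2 (mod 4)`: the logarithm of a unit is never a unit -/

/-- **`f(K/ℚ₂) = 1`, `e(K/ℚ₂) = 2k` with `k` odd ⇒ `‖L(y)‖ ≠ 1` for every principal unit `y`.**
[cite: NeukirchANT1999, Ch. II (5.5)] -/
theorem norm_logSeries_ne_one_of_residueDegree_eq_one {k : ℕ} (hkodd : Odd k)
    (hk : absRamificationIdx 2 K = 2 * k) (hf : residueDegree 2 K = 1) {y : K} (hyP : IsPrincipal y) :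
    ‖logSeries y‖ ≠ 1 := by
  obtain ⟨ϖ, hϖ⟩ := exists_isUniformizer (F := K)
  by_cases hx : 1 - y = 0
  · have : y = 1 := (sub_eq_zero.mp hx).symm
    rw [this, logSeries_one, norm_zero]
    exact zero_ne_one
  obtain ⟨s, hs⟩ := hϖ.2 (Units.mk0 (1 - y) hx)
  rw [Units.val_mk0] at hs
  by_cases hsk : s = k
  · subst hsk
    exact ne_of_lt (norm_logSeries_lt_one_of_eq hϖ hk
      (fun u hu ↦ WildDyadic.isPrincipal_of_residueDegree_eq_one hf hu) hs)
  · exact norm_logSeries_ne_one_of_ne hϖ hkodd hk hyP hs hsk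

/-- **`f(K/ℚ₂) = 1`, `e(K/ℚ₂) ≡ 2 (mod 4)` ⇒ `‖log₂ u‖ ≠ 1` for every `u : K`** (units reduce to principal
units by an odd power, `‖m⁻¹‖ = 1`). Examples: `ℚ₂(√−1)`, `ℚ₂(√2)`, `ℚ₂(√−2)` (`e = 2`, `f = 1`).
[cite: NeukirchANT1999, Ch. II (5.5)] -/
theorem norm_unitLog_ne_one_of_residueDegree_eq_one {k : ℕ} (hkodd : Odd k)
    (hk : absRamificationIdx 2 K = 2 * k) (hf : residueDegree 2 K = 1) (u : K) : ‖unitLog u‖ ≠ 1 := by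
  by_cases hu : ‖u‖ = 1
  · obtain ⟨m, hm0, hmp, hmP⟩ := exists_pow_isPrincipal_not_dvd (p := 2) hu
    rw [unitLog_eq_inv_mul_logSeries 2 hm0 hmP, norm_mul, norm_inv,
      norm_natCast_eq_one_of_not_dvd 2 hmp, inv_one, one_mul]
    exact norm_logSeries_ne_one_of_residueDegree_eq_one hkodd hk hf hmP
  · rw [unitLog_of_norm_ne_one hu, norm_zero]
    exact zero_ne_one

/-- **`f = 1`, `e ≡ 2 (mod 4)` ⇒ `log₂(𝒪_K^×)` misses the unit sphere.** [cite: NeukirchANT1999, Ch. II (5.5)] -/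
theorem logUnits_inter_sphere_eq_empty_of_residueDegree_eq_one {k : ℕ} (hkodd : Odd k)
    (hk : absRamificationIdx 2 K = 2 * k) (hf : residueDegree 2 K = 1) : logUnits K ∩ sphere 0 1 = ∅ := by
  ext z
  simp only [mem_inter_iff, mem_sphere_zero_iff_norm, mem_empty_iff_false, iff_false, not_and]
  rintro ⟨u, -, rfl⟩
  exact norm_unitLog_ne_one_of_residueDegree_eq_one hkodd hk hf u

/-- … so the "second iterate" of `log₂` on units has EMPTY domain there.
[cite: NeukirchANT1999, Ch. II (5.5)] -/
theorem unitLog_image_logUnits_inter_sphere_eq_empty_of_residueDegree_eq_one {k : ℕ} (hkodd : Odd k)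
    (hk : absRamificationIdx 2 K = 2 * k) (hf : residueDegree 2 K = 1) :
    unitLog '' (logUnits K ∩ sphere 0 1) = ∅ := by
  rw [logUnits_inter_sphere_eq_empty_of_residueDegree_eq_one hkodd hk hf, image_empty]

end RamificationCriterion

end Literature.IUT.LogVolume

end
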